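import Summits.Ventures.CertifiedManyBodySolver.Observables.BraggWeightWiener
import Summits.Ventures.CertifiedManyBodySolver.Observables.StripeOrderKernelCeiling
import HarnessLib

/-!
# Lattice symmetries of `C` ⇒ equal Bragg weights on a star; per-arm stripe ceilings

HONEST FRAMING: first certified bounds; not a superconductivity verdict; every number certified or labelled float.

Speedrun `mbsolver`, seat sr-mbsolver-m3-4 (stripe observables), gen 8.  Pure harmonic analysis; 0 compute.

By Wiener's lemma (`Observables/BraggWeightWiener.lean`, `tendsto_boxPairMean_re_braggWeight`) the Bragg weight
`braggWeight μ ![Q]` of ANY finite measure `μ` representing `C : ℤᵈ → ℂ` is the limit of the structure-factor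
means `boxPairMean C Q M`, which see `C` only through differences `x − y` of box points.  Hence every lattice
symmetry of `C` that maps boxes to boxes — coordinate permutations (`boxPairMean_comp_perm`) and coordinate
reflections (`boxPairMean_reflect`) — transports Bragg weights: `braggWeight μ ![Q ∘ p] = braggWeight μ ![Q]`,
`braggWeight μ ![update Q k (−Q k)] = braggWeight μ ![Q]` (`braggWeight_single_comp_perm`, `braggWeight_single_reflect`),
with NO invariance assumption on `μ` itself.  With the disjointness of the Bragg sets of distinct wavevectors in
`(−π, π]ᵈ` (`disjoint_braggSet_of_mem_Ioc`) and additivity (`braggWeight_eq_sum_single`), a D₄-symmetric `C` on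
`ℤ²` (swap and the two coordinate sign flips) puts EQUAL weight on the four arms of the M3 stars:
`braggWeight μ chargeStar = 4 · braggWeight μ ![(π/4, 0)]`, `braggWeight μ spinStar = 4 · braggWeight μ ![(7π/8, π)]`.
Consequently the DERIVED star ceilings of `Observables/StripeOrderKernelCeiling.lean` become PER-ARM ceilings on
the squared stripe order parameter (same dictionary hypotheses, plus the three symmetry hypotheses on `C`, which
the D₄-orbit-mean correlation functions of G2 Stage 2 satisfy by construction):
`braggWeight μ ![(π/4,0)] ≤ 0.0468947` (#262, t′ = 0) / `0.0456555` (#258, t′ = −1/4) (charge, `Q_c = (π/4, 0)`),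
`braggWeight μ ![(7π/8,π)] ≤ 0.0873463` (#263) / `0.0883482` (#259) (spin, `Q_s = (7π/8, π)`).
Not claimed: anything about a state (Stage 2 is pub-mbboot-lit's), any new number.
-/

noncomputable section

namespace Summit.Ventures.CertifiedManyBodySolver.Observables

open MeasureTheory Complex Filter Topology
open scoped Real BigOperators

section General

variable {d : ℕ} {C : (Fin d → ℤ) → ℂ}

/-- Boxes `{0,…,M-1}ᵈ` are invariant under coordinate permutations. -/
theorem comp_perm_mem_box {M : ℕ} (p : Equiv.Perm (Fin d)) {x : Fin d → ℕ}
    (hx : x ∈ Fintype.piFinset fun _ : Fin d => Finset.range M) :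
    x ∘ p ∈ Fintype.piFinset fun _ : Fin d => Finset.range M := by
  rw [Fintype.mem_piFinset] at hx ⊢
  exact fun i => hx (p i)

/-- **Coordinate permutations.**  If `C (r ∘ p) = C r` then the structure-factor means at `Q ∘ p` and `Q` agree. -/
theorem boxPairMean_comp_perm (p : Equiv.Perm (Fin d)) (hC : ∀ r : Fin d → ℤ, C (r ∘ p) = C r)
    (Q : Fin d → ℝ) (M : ℕ) : boxPairMean C (Q ∘ p) M = boxPairMean C Q M := by
  unfold boxPairMean
  congr 1
  symm
  refine Finset.sum_nbij' (fun x => x ∘ p) (fun x => x ∘ p.symm) (fun x hx => comp_perm_mem_box p hx)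
    (fun x hx => comp_perm_mem_box p.symm hx) (fun x _ => by ext i; simp) (fun x _ => by ext i; simp)
    (fun x _ => ?_)
  refine Finset.sum_nbij' (fun y => y ∘ p) (fun y => y ∘ p.symm) (fun y hy => comp_perm_mem_box p hy)
    (fun y hy => comp_perm_mem_box p.symm hy) (fun y _ => by ext i; simp) (fun y _ => by ext i; simp)
    (fun y _ => ?_)
  have hs : (∑ i, (((x ∘ p) i : ℝ) - (y ∘ p) i) * (Q ∘ p) i) = ∑ i, ((x i : ℝ) - y i) * Q i :=
    Equiv.sum_comp p (fun k => ((x k : ℝ) - y k) * Q k)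
  have hc : C (fun i => ((x ∘ p) i : ℤ) - (y ∘ p) i) = C (fun i => (x i : ℤ) - y i) :=
    hC (fun i => (x i : ℤ) - y i)
  rw [hs, hc]

/-- Reflected box coordinates: `(M−1−a) − (M−1−b) = b − a`. -/
theorem natCast_reflect_sub {R : Type*} [CommRing R] {M a b : ℕ} (ha : a < M) (hb : b < M) :
    ((M - 1 - a : ℕ) : R) - ((M - 1 - b : ℕ) : R) = (b : R) - a := by
  rw [Nat.cast_sub (show a ≤ M - 1 by omega), Nat.cast_sub (show b ≤ M - 1 by omega)]
  ring

/-- Boxes are invariant under the reflection `x_k ↦ M − 1 − x_k`. -/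
theorem reflect_mem_box {M : ℕ} (k : Fin d) {x : Fin d → ℕ}
    (hx : x ∈ Fintype.piFinset fun _ : Fin d => Finset.range M) :
    Function.update x k (M - 1 - x k) ∈ Fintype.piFinset fun _ : Fin d => Finset.range M := by
  rw [Fintype.mem_piFinset] at hx ⊢
  intro i
  have := hx k
  rw [Finset.mem_range] at this ⊢
  by_cases hi : i = k
  · subst hi; rw [Function.update_self]; omega
  · rw [Function.update_of_ne hi]; exact Finset.mem_range.mp (hx i)

/-- The box reflection is an involution. -/
theorem reflect_reflect {M : ℕ} (k : Fin d) {x : Fin d → ℕ}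
    (hx : x ∈ Fintype.piFinset fun _ : Fin d => Finset.range M) :
    Function.update (Function.update x k (M - 1 - x k)) k
      (M - 1 - Function.update x k (M - 1 - x k) k) = x := by
  have := Finset.mem_range.mp ((Fintype.mem_piFinset.mp hx) k)
  rw [Function.update_self, Function.update_idem]
  conv_rhs => rw [← Function.update_eq_self k x]
  congr 1
  omega

/-- **Coordinate reflections.**  If `C` is even in coordinate `k` then the structure-factor means at
`Q` with `Q_k ↦ −Q_k` and at `Q` agree. -/
theorem boxPairMean_reflect (k : Fin d) (hC : ∀ r : Fin d → ℤ, C (Function.update r k (-r k)) = C r)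
    (Q : Fin d → ℝ) (M : ℕ) :
    boxPairMean C (Function.update Q k (-Q k)) M = boxPairMean C Q M := by
  unfold boxPairMean
  congr 1
  symm
  refine Finset.sum_nbij' (fun x => Function.update x k (M - 1 - x k))
    (fun x => Function.update x k (M - 1 - x k)) (fun x hx => reflect_mem_box k hx)
    (fun x hx => reflect_mem_box k hx) (fun x hx => reflect_reflect k hx) (fun x hx => reflect_reflect k hx)
    (fun x hx => ?_)
  refine Finset.sum_nbij' (fun y => Function.update y k (M - 1 - y k))
    (fun y => Function.update y k (M - 1 - y k)) (fun y hy => reflect_mem_box k hy)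
    (fun y hy => reflect_mem_box k hy) (fun y hy => reflect_reflect k hy) (fun y hy => reflect_reflect k hy)
    (fun y hy => ?_)
  have hxk := Finset.mem_range.mp ((Fintype.mem_piFinset.mp hx) k)
  have hyk := Finset.mem_range.mp ((Fintype.mem_piFinset.mp hy) k)
  have hs : (∑ i, (((Function.update x k (M - 1 - x k)) i : ℝ) - (Function.update y k (M - 1 - y k)) i)
      * (Function.update Q k (-Q k)) i) = ∑ i, ((x i : ℝ) - y i) * Q i := by
    refine Finset.sum_congr rfl fun i _ => ?_
    by_cases hi : i = k
    · subst hi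
      rw [Function.update_self, Function.update_self, Function.update_self, natCast_reflect_sub hxk hyk]
      ring
    · rw [Function.update_of_ne hi, Function.update_of_ne hi, Function.update_of_ne hi]
  have hc : C (fun i => ((Function.update x k (M - 1 - x k)) i : ℤ) - (Function.update y k (M - 1 - y k)) i)
      = C (fun i => (x i : ℤ) - y i) := by
    rw [← hC (fun i => (x i : ℤ) - y i)]
    congr 1
    ext i
    by_cases hi : i = k
    · subst hi
      rw [Function.update_self, Function.update_self, Function.update_self, natCast_reflect_sub hxk hyk]
      ring
    · rw [Function.update_of_ne hi, Function.update_of_ne hi, Function.update_of_ne hi]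
  rw [hs, hc]

variable (μ : Measure (EuclideanSpace ℝ (Fin d))) [IsFiniteMeasure μ]

/-- Bragg weights are transported by coordinate permutations of a `C`-symmetry (no assumption on `μ`). -/
theorem braggWeight_single_comp_perm
    (hμ : ∀ r : Fin d → ℤ, ∫ ξ, exp ((∑ i, (r i : ℝ) * ξ i : ℝ) * I) ∂μ = C r)
    (p : Equiv.Perm (Fin d)) (hC : ∀ r : Fin d → ℤ, C (r ∘ p) = C r) (Q : Fin d → ℝ) :
    braggWeight μ ![Q ∘ p] = braggWeight μ ![Q] := by
  refine tendsto_nhds_unique (tendsto_boxPairMean_re_braggWeight μ hμ (Q ∘ p)) ?_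
  have h := tendsto_boxPairMean_re_braggWeight μ hμ Q
  have hF : (fun M => (boxPairMean C Q M).re) = fun M => (boxPairMean C (Q ∘ p) M).re :=
    funext fun M => by rw [boxPairMean_comp_perm p hC Q M]
  rwa [hF] at h

/-- Bragg weights are transported by coordinate reflections of a `C`-symmetry (no assumption on `μ`). -/
theorem braggWeight_single_reflect
    (hμ : ∀ r : Fin d → ℤ, ∫ ξ, exp ((∑ i, (r i : ℝ) * ξ i : ℝ) * I) ∂μ = C r)
    (k : Fin d) (hC : ∀ r : Fin d → ℤ, C (Function.update r k (-r k)) = C r) (Q : Fin d → ℝ) :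
    braggWeight μ ![Function.update Q k (-Q k)] = braggWeight μ ![Q] := by
  refine tendsto_nhds_unique (tendsto_boxPairMean_re_braggWeight μ hμ _) ?_
  have h := tendsto_boxPairMean_re_braggWeight μ hμ Q
  have hF : (fun M => (boxPairMean C Q M).re) = fun M => (boxPairMean C (Function.update Q k (-Q k)) M).re :=
    funext fun M => by rw [boxPairMean_reflect k hC Q M]
  rwa [hF] at h

/-- Distinct wavevectors in the cell `(−π, π]ᵈ` have disjoint Bragg sets. -/
theorem disjoint_braggSet_of_mem_Ioc {Q Q' : Fin d → ℝ} (hQ : ∀ i, Q i ∈ Set.Ioc (-π) π)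
    (hQ' : ∀ i, Q' i ∈ Set.Ioc (-π) π) (hne : Q ≠ Q') : Disjoint (braggSet Q) (braggSet Q') := by
  rw [Set.disjoint_left]
  rintro ξ ⟨m, hm⟩ ⟨m', hm'⟩
  apply hne
  funext i
  have h1 := hm i
  have h2 := hm' i
  obtain ⟨ha, hb⟩ := hQ i
  obtain ⟨ha', hb'⟩ := hQ' i
  have h2π : (0 : ℝ) < 2 * π := by positivity
  set δ : ℤ := m' i - m i with hδdef
  have hδ : 2 * π * (δ : ℝ) = Q i - Q' i := by
    rw [hδdef]
    push_cast
    linear_combination h1 - h2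
  have hlt : δ < 1 := by
    by_contra hc
    have hc' : (1 : ℝ) ≤ (δ : ℝ) := by exact_mod_cast not_lt.mp hc
    have := mul_le_mul_of_nonneg_left hc' h2π.le
    linarith
  have hgt : -1 < δ := by
    by_contra hc
    have hc' : (δ : ℝ) ≤ -1 := by exact_mod_cast not_lt.mp hc
    have := mul_le_mul_of_nonneg_left hc' h2π.le
    linarith
  have h0 : (δ : ℝ) = 0 := by exact_mod_cast (show δ = 0 by omega)
  rw [h0, mul_zero] at hδ
  linarith

omit [IsFiniteMeasure μ] in
/-- Additivity: for pairwise-disjoint Bragg sets the star weight is the sum of the single weights. -/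
theorem braggWeight_eq_sum_single {n : ℕ} (Q : Fin n → (Fin d → ℝ))
    (h : Pairwise fun j j' => Disjoint (braggSet (Q j)) (braggSet (Q j'))) [IsFiniteMeasure μ] :
    braggWeight μ Q = ∑ j, braggWeight μ ![Q j] := by
  simp_rw [braggWeight_single]
  unfold braggWeight Measure.real
  rw [measure_iUnion h (fun j => measurableSet_braggSet _), tsum_fintype,
    ENNReal.toReal_sum (fun j _ => measure_ne_top μ _)]

end General

/-! ### The M3 stars (d = 2): equal arms under D₄-symmetry of `C` -/

section Stars

variable {C : (Fin 2 → ℤ) → ℂ} (μ : Measure (EuclideanSpace ℝ (Fin 2))) [IsFiniteMeasure μ]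

/-- The charge-stripe star arms lie in `(−π, π]²`. -/
theorem chargeStar_mem_Ioc (j : Fin 4) (i : Fin 2) : chargeStar j i ∈ Set.Ioc (-π) π := by
  have hπ := Real.pi_pos
  fin_cases j <;> fin_cases i <;> simp [chargeStar] <;> constructor <;> linarith

/-- The spin-stripe star arms lie in `(−π, π]²`. -/
theorem spinStar_mem_Ioc (j : Fin 4) (i : Fin 2) : spinStar j i ∈ Set.Ioc (-π) π := by
  have hπ := Real.pi_pos
  fin_cases j <;> fin_cases i <;> simp [spinStar] <;> (try constructor) <;> linarith

/-- The four charge arms are distinct. -/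
theorem chargeStar_injective : Function.Injective chargeStar := by
  have hπ := Real.pi_pos
  intro j j' h
  have h0 := congrFun h 0
  have h1 := congrFun h 1
  fin_cases j <;> fin_cases j' <;> (try rfl)
  all_goals (exfalso; simp [chargeStar] at h0 h1)
  all_goals linarith

/-- The four spin arms are distinct. -/
theorem spinStar_injective : Function.Injective spinStar := by
  have hπ := Real.pi_pos
  intro j j' h
  have h0 := congrFun h 0
  have h1 := congrFun h 1
  fin_cases j <;> fin_cases j' <;> (try rfl)
  all_goals (exfalso; simp [spinStar] at h0 h1)
  all_goals linarith

/-- The charge arms have pairwise-disjoint Bragg sets. -/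
theorem chargeStar_pairwise_disjoint :
    Pairwise fun j j' => Disjoint (braggSet (chargeStar j)) (braggSet (chargeStar j')) :=
  fun _ _ hne => disjoint_braggSet_of_mem_Ioc (chargeStar_mem_Ioc _) (chargeStar_mem_Ioc _)
    fun h => hne (chargeStar_injective h)

/-- The spin arms have pairwise-disjoint Bragg sets. -/
theorem spinStar_pairwise_disjoint :
    Pairwise fun j j' => Disjoint (braggSet (spinStar j)) (braggSet (spinStar j')) :=
  fun _ _ hne => disjoint_braggSet_of_mem_Ioc (spinStar_mem_Ioc _) (spinStar_mem_Ioc _)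
    fun h => hne (spinStar_injective h)

/-- **Equal charge arms.**  If `C` is D₄-symmetric (swap, and even in each coordinate) then every
representing `μ` puts equal Bragg weight on the four arms: `braggWeight μ chargeStar = 4 · braggWeight μ ![(π/4,0)]`. -/
theorem chargeStar_braggWeight_eq_four_mul
    (hμ : ∀ r : Fin 2 → ℤ, ∫ ξ, exp ((∑ i, (r i : ℝ) * ξ i : ℝ) * I) ∂μ = C r)
    (hswap : ∀ r : Fin 2 → ℤ, C (r ∘ Equiv.swap 0 1) = C r)
    (hrefl0 : ∀ r : Fin 2 → ℤ, C (Function.update r 0 (-r 0)) = C r)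
    (hrefl1 : ∀ r : Fin 2 → ℤ, C (Function.update r 1 (-r 1)) = C r) :
    braggWeight μ chargeStar = 4 * braggWeight μ ![![π / 4, 0]] := by
  rw [braggWeight_eq_sum_single μ chargeStar chargeStar_pairwise_disjoint, Fin.sum_univ_four]
  have e1 : chargeStar 1 = Function.update (chargeStar 0) 0 (-chargeStar 0 0) := by
    ext i; fin_cases i <;> simp [chargeStar]
  have e2 : chargeStar 2 = chargeStar 0 ∘ Equiv.swap 0 1 := by
    ext i; fin_cases i <;> simp [chargeStar]
  have e3 : chargeStar 3 = Function.update (chargeStar 2) 1 (-chargeStar 2 1) := by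
    ext i; fin_cases i <;> simp [chargeStar]
  have h1 : braggWeight μ ![chargeStar 1] = braggWeight μ ![chargeStar 0] := by
    rw [e1]; exact braggWeight_single_reflect μ hμ 0 hrefl0 _
  have h2 : braggWeight μ ![chargeStar 2] = braggWeight μ ![chargeStar 0] := by
    rw [e2]; exact braggWeight_single_comp_perm μ hμ _ hswap _
  have h3 : braggWeight μ ![chargeStar 3] = braggWeight μ ![chargeStar 0] := by
    rw [e3, braggWeight_single_reflect μ hμ 1 hrefl1 _, h2]
  have e0 : chargeStar 0 = ![π / 4, 0] := by
    ext i; fin_cases i <;> simp [chargeStar]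
  rw [h1, h2, h3, e0]
  ring

/-- **Equal spin arms**: `braggWeight μ spinStar = 4 · braggWeight μ ![(7π/8, π)]` for D₄-symmetric `C`. -/
theorem spinStar_braggWeight_eq_four_mul
    (hμ : ∀ r : Fin 2 → ℤ, ∫ ξ, exp ((∑ i, (r i : ℝ) * ξ i : ℝ) * I) ∂μ = C r)
    (hswap : ∀ r : Fin 2 → ℤ, C (r ∘ Equiv.swap 0 1) = C r)
    (hrefl0 : ∀ r : Fin 2 → ℤ, C (Function.update r 0 (-r 0)) = C r)
    (hrefl1 : ∀ r : Fin 2 → ℤ, C (Function.update r 1 (-r 1)) = C r) :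
    braggWeight μ spinStar = 4 * braggWeight μ ![![7 * π / 8, π]] := by
  rw [braggWeight_eq_sum_single μ spinStar spinStar_pairwise_disjoint, Fin.sum_univ_four]
  have e1 : spinStar 1 = Function.update (spinStar 0) 0 (-spinStar 0 0) := by
    ext i; fin_cases i <;> simp [spinStar]
  have e2 : spinStar 2 = spinStar 0 ∘ Equiv.swap 0 1 := by
    ext i; fin_cases i <;> simp [spinStar]
  have e3 : spinStar 3 = Function.update (spinStar 2) 1 (-spinStar 2 1) := by
    ext i; fin_cases i <;> simp [spinStar]
  have h1 : braggWeight μ ![spinStar 1] = braggWeight μ ![spinStar 0] := by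
    rw [e1]; exact braggWeight_single_reflect μ hμ 0 hrefl0 _
  have h2 : braggWeight μ ![spinStar 2] = braggWeight μ ![spinStar 0] := by
    rw [e2]; exact braggWeight_single_comp_perm μ hμ _ hswap _
  have h3 : braggWeight μ ![spinStar 3] = braggWeight μ ![spinStar 0] := by
    rw [e3, braggWeight_single_reflect μ hμ 1 hrefl1 _, h2]
  have e0 : spinStar 0 = ![7 * π / 8, π] := by
    ext i; fin_cases i <;> simp [spinStar]
  rw [h1, h2, h3, e0]
  ring

/-! ### Per-arm ceilings (rows #262/#258 charge, #263/#259 spin) -/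

/-- **Per-arm charge-stripe ceiling, #262 (`t′ = 0`)**: `braggWeight μ ![(π/4,0)] ≤ 0.0468947`. -/
theorem chargeArm_braggWeight_le_r262
    (hμ : ∀ r : Fin 2 → ℤ, ∫ ξ, exp ((∑ i, (r i : ℝ) * ξ i : ℝ) * I) ∂μ = C r)
    (hswap : ∀ r : Fin 2 → ℤ, C (r ∘ Equiv.swap 0 1) = C r)
    (hrefl0 : ∀ r : Fin 2 → ℤ, C (Function.update r 0 (-r 0)) = C r)
    (hrefl1 : ∀ r : Fin 2 → ℤ, C (Function.update r 1 (-r 1)) = C r)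
    {docc densnn : ℝ}
    (h0 : (C ![0, 0]).re = 7/64 + 2 * docc)
    (h1 : (C ![1, 0]).re = densnn - 49/64) (h2 : (C ![-1, 0]).re = densnn - 49/64)
    (h3 : (C ![0, 1]).re = densnn - 49/64) (h4 : (C ![0, -1]).re = densnn - 49/64)
    (hrow : 17/18 * docc + 1/3 * densnn
      ≤ (240590927261308892318093707/696341272098026404630757376 : ℝ)) :
    braggWeight μ ![![π / 4, 0]] ≤ 0.0468947 := by
  have h := chargeStar_braggWeight_le_r262 μ hμ h0 h1 h2 h3 h4 hrow
  rw [chargeStar_braggWeight_eq_four_mul μ hμ hswap hrefl0 hrefl1] at h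
  linarith

/-- **Per-arm charge-stripe ceiling, #258 (`t′ = −1/4`)**: `braggWeight μ ![(π/4,0)] ≤ 0.0456555`. -/
theorem chargeArm_braggWeight_le_r258
    (hμ : ∀ r : Fin 2 → ℤ, ∫ ξ, exp ((∑ i, (r i : ℝ) * ξ i : ℝ) * I) ∂μ = C r)
    (hswap : ∀ r : Fin 2 → ℤ, C (r ∘ Equiv.swap 0 1) = C r)
    (hrefl0 : ∀ r : Fin 2 → ℤ, C (Function.update r 0 (-r 0)) = C r)
    (hrefl1 : ∀ r : Fin 2 → ℤ, C (Function.update r 1 (-r 1)) = C r)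
    {docc densnn : ℝ}
    (h0 : (C ![0, 0]).re = 7/64 + 2 * docc)
    (h1 : (C ![1, 0]).re = densnn - 49/64) (h2 : (C ![-1, 0]).re = densnn - 49/64)
    (h3 : (C ![0, 1]).re = densnn - 49/64) (h4 : (C ![0, -1]).re = densnn - 49/64)
    (hrow : 17/18 * docc + 1/3 * densnn
      ≤ (7436845310014878667396889/21760664753063325144711168 : ℝ)) :
    braggWeight μ ![![π / 4, 0]] ≤ 0.0456555 := by
  have h := chargeStar_braggWeight_le_r258 μ hμ h0 h1 h2 h3 h4 hrow
  rw [chargeStar_braggWeight_eq_four_mul μ hμ hswap hrefl0 hrefl1] at h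
  linarith

/-- **Per-arm spin-stripe ceiling, #263 (`t′ = 0`)**: `braggWeight μ ![(7π/8,π)] ≤ 0.0873463`. -/
theorem spinArm_braggWeight_le_r263
    (hμ : ∀ r : Fin 2 → ℤ, ∫ ξ, exp ((∑ i, (r i : ℝ) * ξ i : ℝ) * I) ∂μ = C r)
    (hswap : ∀ r : Fin 2 → ℤ, C (r ∘ Equiv.swap 0 1) = C r)
    (hrefl0 : ∀ r : Fin 2 → ℤ, C (Function.update r 0 (-r 0)) = C r)
    (hrefl1 : ∀ r : Fin 2 → ℤ, C (Function.update r 1 (-r 1)) = C r)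
    {docc spinnn spinnnn : ℝ}
    (h0 : (C ![0, 0]).re = 3/4 * (7/8 - 2 * docc))
    (h1 : (C ![1, 0]).re = spinnn) (h2 : (C ![0, 1]).re = spinnn)
    (h3 : (C ![1, 1]).re = spinnnn) (h4 : (C ![1, -1]).re = spinnnn)
    (hrow : -(3/2) * docc - 2 * spinnn + spinnnn
      ≤ (415930155155353846419951/604462909807314587353088 : ℝ)) :
    braggWeight μ ![![7 * π / 8, π]] ≤ 0.0873463 := by
  have h := spinStar_braggWeight_le_r263 μ hμ h0 h1 h2 h3 h4 hrow
  rw [spinStar_braggWeight_eq_four_mul μ hμ hswap hrefl0 hrefl1] at h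
  linarith

/-- **Per-arm spin-stripe ceiling, #259 (`t′ = −1/4`)**: `braggWeight μ ![(7π/8,π)] ≤ 0.0883482`. -/
theorem spinArm_braggWeight_le_r259
    (hμ : ∀ r : Fin 2 → ℤ, ∫ ξ, exp ((∑ i, (r i : ℝ) * ξ i : ℝ) * I) ∂μ = C r)
    (hswap : ∀ r : Fin 2 → ℤ, C (r ∘ Equiv.swap 0 1) = C r)
    (hrefl0 : ∀ r : Fin 2 → ℤ, C (Function.update r 0 (-r 0)) = C r)
    (hrefl1 : ∀ r : Fin 2 → ℤ, C (Function.update r 1 (-r 1)) = C r)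
    {docc spinnn spinnnn : ℝ}
    (h0 : (C ![0, 0]).re = 3/4 * (7/8 - 2 * docc))
    (h1 : (C ![1, 0]).re = spinnn) (h2 : (C ![0, 1]).re = spinnn)
    (h3 : (C ![1, 1]).re = spinnnn) (h4 : (C ![1, -1]).re = spinnnn)
    (hrow : -(3/2) * docc - 2 * spinnn + spinnnn
      ≤ (850503059816907488315749/1208925819614629174706176 : ℝ)) :
    braggWeight μ ![![7 * π / 8, π]] ≤ 0.0883482 := by
  have h := spinStar_braggWeight_le_r259 μ hμ h0 h1 h2 h3 h4 hrow
  rw [spinStar_braggWeight_eq_four_mul μ hμ hswap hrefl0 hrefl1] at h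
  linarith

end Stars

end Summit.Ventures.CertifiedManyBodySolver.Observables

end
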